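import Summits.ValiantsHypothesis.ValiantsHypothesis.Theorems.BarrierLeverPriorityPeelingPairMove

/-!
# Route BarrierLever — the SHEAR MOVE of the priority-peeling calculus for TT (item 19152 / core 19616)

Helper file (`--supports stmt-ValiantsHypothesis-19152`; cell valiant-natproofs, rung V4, 𝒟-side;
prover gen 7; memo `HOME/prover/gen7/PP-MEMO-g7.md` §2/§5; companion of
`…PriorityPeelingPairMove` (`PriorityPeeling.pairMove`)). Closes NO item.

**Setting** (as in the pair-move file). A configuration is a family of row index maps
`R i : Fin e → Fin nr` and column index maps `C j : Fin e → Fin nc` (`i, j : Fin r`) into a generic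
matrix `G`; its layout matrix is `(det G[R i, C j])_{ij}`; ALIVE = nonsingular for some `G`.

**The shear move (`shearMove`).** Fix two column literals `x ≠ y`. A column `j` is AFFECTED when
`C j` (injective) hits `x`, at position `qx j`, and avoids `y`; the SHEARED configuration replaces
`x` by `y` in every affected column (`Function.update (C j) (qx j) y`, same position — no sign) and
keeps the other columns. CLAIM: if some `G'` makes the sheared layout matrix nonsingular, some `G`
makes the original one nonsingular. PROOF: over `ℂ[X]` replace column `x` of `G'` by
`col x + X · col y`; a minor through an affected column becomes `det + X · det(sheared minor)`
(multilinearity, `Matrix.det_updateCol_add/smul`), a minor through a column hitting both `x` and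
`y` is unchanged (`Matrix.det_updateCol_add_smul_self`), a minor avoiding `x` is constant; so entry
`(i,j)` of the layout matrix has degree `≤ [j affected]` and the coefficient of `X^{#affected}` in
its determinant is the sheared layout determinant (`PriorityPeeling.coeff_det_of_natDegree_le_col`),
nonzero by hypothesis; evaluate at a non-root. The within-pair ROW shear of R2 (item 19588) is the
transposed statement; in the memo's search this move is used with budget 1 before pair moves.

WHAT THIS IS NOT: one reduction step, kernel-checked; nothing on the existence of certificates, on
TT / TNS / item 19717 in general, on crux stmt-ValiantsHypothesis-14610, or on `VP` versus `VNP`.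
-/

-- layout Summits/ValiantsHypothesis/ValiantsHypothesis forces the duplicated namespace component
set_option linter.dupNamespace false

namespace Summit.ValiantsHypothesis.ValiantsHypothesis.Theorems.BarrierLever.PriorityPeeling

open Finset Polynomial Matrix

section Shear

variable {nr nc e : ℕ}

/- The «sheared matrix» over `ℂ[X]`: column `x` of `G'` becomes `col x + X · col y`, the other
columns are constant (written out in full; no definition is introduced). -/

/-- A minor of the sheared matrix through a column map AVOIDING `x` is constant. -/
theorem shear_minor_const (G' : Matrix (Fin nr) (Fin nc) ℂ) (x y : Fin nc) (ρ : Fin e → Fin nr)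
    (κ : Fin e → Fin nc) (hx : ∀ q, κ q ≠ x) :
    ((Matrix.of fun a m => if m = x then Polynomial.C (G' a x) + X * Polynomial.C (G' a y)
        else Polynomial.C (G' a m) : Matrix (Fin nr) (Fin nc) ℂ[X]).submatrix ρ κ).det =
      Polynomial.C ((G'.submatrix ρ κ).det) := by
  have hsub : (Matrix.of fun a m => if m = x then Polynomial.C (G' a x) + X * Polynomial.C (G' a y)
      else Polynomial.C (G' a m) : Matrix (Fin nr) (Fin nc) ℂ[X]).submatrix ρ κ =
      (G'.submatrix ρ κ).map Polynomial.C := by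
    ext a q
    simp only [Matrix.submatrix_apply, Matrix.of_apply, Matrix.map_apply, if_neg (hx q)]
  rw [hsub]
  exact (RingHom.map_det (Polynomial.C : ℂ →+* ℂ[X]) _).symm

/-- A minor of the sheared matrix through an INJECTIVE column map hitting `x` at `q₀`: it is the
constant minor with column `q₀` updated to `col x + X · col y`. -/
theorem shear_submatrix_eq_updateCol (G' : Matrix (Fin nr) (Fin nc) ℂ) (x y : Fin nc)
    (ρ : Fin e → Fin nr) (κ : Fin e → Fin nc) (hκ : Function.Injective κ) (q₀ : Fin e)
    (hq₀ : κ q₀ = x) :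
    (Matrix.of fun a m => if m = x then Polynomial.C (G' a x) + X * Polynomial.C (G' a y)
        else Polynomial.C (G' a m) : Matrix (Fin nr) (Fin nc) ℂ[X]).submatrix ρ κ =
      ((G'.submatrix ρ κ).map Polynomial.C).updateCol q₀
        ((fun a => Polynomial.C (G' (ρ a) x)) + (X : ℂ[X]) • (fun a => Polynomial.C (G' (ρ a) y))) := by
  ext a q
  simp only [Matrix.submatrix_apply, Matrix.of_apply, Matrix.updateCol_apply, Matrix.map_apply,
    Pi.add_apply, Pi.smul_apply, smul_eq_mul]
  by_cases hq : q = q₀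
  · subst hq
    rw [if_pos hq₀, if_pos rfl]
  · have hne : κ q ≠ x := fun h => hq (hκ (h.trans hq₀.symm))
    rw [if_neg hne, if_neg hq]

/-- The affected case: `κ` injective, hits `x` at `q₀`, avoids `y`. The minor is
`det + X · det(sheared minor)`. -/
theorem shear_minor_affected (G' : Matrix (Fin nr) (Fin nc) ℂ) (x y : Fin nc)
    (ρ : Fin e → Fin nr) (κ : Fin e → Fin nc) (hκ : Function.Injective κ) (q₀ : Fin e)
    (hq₀ : κ q₀ = x) :
    ((Matrix.of fun a m => if m = x then Polynomial.C (G' a x) + X * Polynomial.C (G' a y)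
        else Polynomial.C (G' a m) : Matrix (Fin nr) (Fin nc) ℂ[X]).submatrix ρ κ).det =
      Polynomial.C ((G'.submatrix ρ κ).det) +
        X * Polynomial.C ((G'.submatrix ρ (Function.update κ q₀ y)).det) := by
  rw [shear_submatrix_eq_updateCol G' x y ρ κ hκ q₀ hq₀, Matrix.det_updateCol_add,
    Matrix.det_updateCol_smul]
  have h1 : ((G'.submatrix ρ κ).map Polynomial.C).updateCol q₀ (fun a => Polynomial.C (G' (ρ a) x))
      = (G'.submatrix ρ κ).map Polynomial.C := by
    have : (fun a => Polynomial.C (G' (ρ a) x)) =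
        fun a => ((G'.submatrix ρ κ).map Polynomial.C) a q₀ := by
      funext a
      simp only [Matrix.map_apply, Matrix.submatrix_apply, hq₀]
    rw [this, Matrix.updateCol_eq_self]
  have h2 : ((G'.submatrix ρ κ).map Polynomial.C).updateCol q₀ (fun a => Polynomial.C (G' (ρ a) y))
      = (G'.submatrix ρ (Function.update κ q₀ y)).map Polynomial.C := by
    ext a q
    simp only [Matrix.updateCol_apply, Matrix.map_apply, Matrix.submatrix_apply, Function.update_apply]
    split_ifs <;> rfl
  have e1 : ((G'.submatrix ρ κ).map Polynomial.C).det = Polynomial.C ((G'.submatrix ρ κ).det) :=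
    (RingHom.map_det (Polynomial.C : ℂ →+* ℂ[X]) _).symm
  have e2 : ((G'.submatrix ρ (Function.update κ q₀ y)).map Polynomial.C).det =
      Polynomial.C ((G'.submatrix ρ (Function.update κ q₀ y)).det) :=
    (RingHom.map_det (Polynomial.C : ℂ →+* ℂ[X]) _).symm
  rw [h1, h2, e1, e2]

/-- The neutral case: `κ` injective, hits `x` at `q₀` AND hits `y` (at `q₁`). The minor is
unchanged (a multiple of another column was added). -/
theorem shear_minor_neutral (G' : Matrix (Fin nr) (Fin nc) ℂ) (x y : Fin nc) (hxy : x ≠ y)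
    (ρ : Fin e → Fin nr) (κ : Fin e → Fin nc) (hκ : Function.Injective κ) (q₀ q₁ : Fin e)
    (hq₀ : κ q₀ = x) (hq₁ : κ q₁ = y) :
    ((Matrix.of fun a m => if m = x then Polynomial.C (G' a x) + X * Polynomial.C (G' a y)
        else Polynomial.C (G' a m) : Matrix (Fin nr) (Fin nc) ℂ[X]).submatrix ρ κ).det =
      Polynomial.C ((G'.submatrix ρ κ).det) := by
  have hne : q₀ ≠ q₁ := fun h => hxy (hq₀.symm.trans ((congrArg κ h).trans hq₁))
  rw [shear_submatrix_eq_updateCol G' x y ρ κ hκ q₀ hq₀]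
  have : ((fun a => Polynomial.C (G' (ρ a) x)) + (X : ℂ[X]) • (fun a => Polynomial.C (G' (ρ a) y))) =
      fun a => ((G'.submatrix ρ κ).map Polynomial.C) a q₀ +
        (X : ℂ[X]) • ((G'.submatrix ρ κ).map Polynomial.C) a q₁ := by
    funext a
    simp only [Pi.add_apply, Pi.smul_apply, Matrix.map_apply, Matrix.submatrix_apply, hq₀, hq₁]
  rw [this, Matrix.det_updateCol_add_smul_self _ hne]
  exact (RingHom.map_det (Polynomial.C : ℂ →+* ℂ[X]) _).symm

/-- **THE SHEAR MOVE** (memo PP-MEMO-g7 §2, kernel form). Columns are injective index maps; `aff j`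
marks the affected columns (hit `x` at `qx j`, avoid `y`); unaffected columns either avoid `x` or hit
`y`. If some `G'` makes the SHEARED layout matrix (affected columns updated `x ↦ y` in place)
nonsingular, some `G` makes the original layout matrix nonsingular. -/
theorem shearMove {r : ℕ} (R : Fin r → Fin e → Fin nr) (C : Fin r → Fin e → Fin nc)
    (hC : ∀ j, Function.Injective (C j)) (x y : Fin nc) (hxy : x ≠ y) (aff : Fin r → Bool)
    (qx : Fin r → Fin e)
    (haff : ∀ j, aff j = true → C j (qx j) = x ∧ ∀ q, C j q ≠ y)
    (hunaff : ∀ j, aff j = false → (∀ q, C j q ≠ x) ∨ (∃ q, C j q = y))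
    (hsheared : ∃ G' : Matrix (Fin nr) (Fin nc) ℂ,
      (Matrix.of fun i j : Fin r => (G'.submatrix (R i)
        (if aff j then Function.update (C j) (qx j) y else C j)).det).det ≠ 0) :
    ∃ G : Matrix (Fin nr) (Fin nc) ℂ,
      (Matrix.of fun i j : Fin r => (G.submatrix (R i) (C j)).det).det ≠ 0 := by
  obtain ⟨G', hG'⟩ := hsheared
  set Gs : Matrix (Fin nr) (Fin nc) ℂ[X] := (Matrix.of fun a m =>
    if m = x then Polynomial.C (G' a x) + X * Polynomial.C (G' a y) else Polynomial.C (G' a m))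
    with hGs_def
  set Ls : Matrix (Fin r) (Fin r) ℂ[X] :=
    Matrix.of fun i j : Fin r => (Gs.submatrix (R i) (C j)).det with hLs_def
  -- entries: degree ≤ [aff j], coefficients
  have hentry_aff : ∀ i j, aff j = true → Ls i j = Polynomial.C ((G'.submatrix (R i) (C j)).det) +
      X * Polynomial.C ((G'.submatrix (R i) (Function.update (C j) (qx j) y)).det) := by
    intro i j hj
    rw [hLs_def, Matrix.of_apply, hGs_def]
    exact shear_minor_affected G' x y (R i) (C j) (hC j) (qx j) (haff j hj).1
  have hentry_unaff : ∀ i j, aff j = false →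
      Ls i j = Polynomial.C ((G'.submatrix (R i) (C j)).det) := by
    intro i j hj
    rw [hLs_def, Matrix.of_apply, hGs_def]
    rcases hunaff j hj with hx | ⟨q₁, hq₁⟩
    · exact shear_minor_const G' x y (R i) (C j) hx
    · by_cases hx : ∃ q, C j q = x
      · obtain ⟨q₀, hq₀⟩ := hx
        exact shear_minor_neutral G' x y hxy (R i) (C j) (hC j) q₀ q₁ hq₀ hq₁
      · exact shear_minor_const G' x y (R i) (C j) (fun q h => hx ⟨q, h⟩)
  have hdeg : ∀ i j, (Ls i j).natDegree ≤ (if aff j then 1 else 0) := by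
    intro i j
    cases hj : aff j
    · rw [hentry_unaff i j hj, natDegree_C]
      exact le_rfl
    · rw [hentry_aff i j hj]
      show _ ≤ 1
      refine (natDegree_add_le _ _).trans (max_le ((natDegree_C _).le.trans zero_le_one) ?_)
      exact (natDegree_mul_le).trans (by rw [natDegree_X, natDegree_C])
  have hcoeff : ∀ i j, (Ls i j).coeff (if aff j then 1 else 0) =
      (G'.submatrix (R i) (if aff j then Function.update (C j) (qx j) y else C j)).det := by
    intro i j
    cases hj : aff j
    · rw [hentry_unaff i j hj]
      simp only [Bool.false_eq_true, if_false, coeff_C_zero]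
    · rw [hentry_aff i j hj]
      simp only [if_true, coeff_add, coeff_C_succ, coeff_X_mul, coeff_C_zero, zero_add]
  have hLs : Ls.det ≠ 0 := by
    intro h0
    have hc := coeff_det_of_natDegree_le_col Ls (fun j => if aff j then 1 else 0) hdeg
    rw [h0, coeff_zero] at hc
    have hmat : (Matrix.of fun i j => (Ls i j).coeff (if aff j then 1 else 0)) =
        Matrix.of fun i j : Fin r => (G'.submatrix (R i)
          (if aff j then Function.update (C j) (qx j) y else C j)).det := by
      refine Matrix.ext (fun i j => ?_)
      rw [Matrix.of_apply, Matrix.of_apply, hcoeff]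
    rw [hmat] at hc
    exact hG' hc.symm
  obtain ⟨t, ht⟩ := exists_eval_ne_zero_of_ne_zero _ hLs
  refine ⟨Gs.map (Polynomial.eval t), ?_⟩
  have hev : (Matrix.of fun i j : Fin r => ((Gs.map (Polynomial.eval t)).submatrix (R i) (C j)).det)
      = (Polynomial.evalRingHom t).mapMatrix Ls := by
    refine Matrix.ext (fun i j => ?_)
    have h1 : ((Polynomial.evalRingHom t).mapMatrix Ls) i j
        = Polynomial.evalRingHom t ((Gs.submatrix (R i) (C j)).det) := by
      simp only [RingHom.mapMatrix_apply, Matrix.map_apply, hLs_def, Matrix.of_apply]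
    rw [h1, RingHom.map_det, RingHom.mapMatrix_apply, Matrix.of_apply, ← Matrix.submatrix_map]
    rfl
  rw [hev, ← RingHom.map_det]
  exact ht

end Shear

end Summit.ValiantsHypothesis.ValiantsHypothesis.Theorems.BarrierLever.PriorityPeeling
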